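import Literature.Analysis.FluidPDE.PassiveVectorTensorGalerkinIdentity
import Literature.Analysis.FunctionSpaces.TorusFourierModes
import HarnessLib

/-!
# Weak tensor-viscosity passive-vector solutions: the energy identity of an ARBITRARY finite block of
# Fourier modes, and the block flux as a remainder

Analysis/FluidPDE proof-support file (everything proved; no definitions, no named facts).  The tree's
`PassiveVectorTensorGalerkinIdentity` runs the Galerkin energy argument on the weak solution itself for the
frequency BALLS `|k| ≤ N` (`fourierTruncate N`).  Here the same identities are written for an arbitrary finite
set `S` of frequencies, the block projection being the real trigonometric polynomial
`P_S w(s) := realTrigPoly S (ŵ(s))` (Robinson–Rodrigo–Sadowski 2016, §4.1–§4.2: the Galerkin system tested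
against a sub-family of its own modes):

* `ae_blockFlux_eq_sum` — `∫⟪w(s),(b(s)·∇)P_S w(s)⟫ + A∫⟪b(s),(w(s)·∇)P_S w(s)⟫ = Σ_{k∈S} Re B_k(ŵ(s)(k))(s)` for
  a.e. `s` and every `S`;
* `integrableOn_blockFlux`, `integrableOn_blockSymbForm` — integrability on `(0,T)`;
* `ae_block_energy_identity` — **the block energy identity**: for an `L²` weakly divergence-free datum, a.e.
  `t ∈ (0,T)` and every finite `S`,
  `Σ_{k∈S} ‖ŵ(t)(k)‖² + 2∫_{(0,t]} Q_S = Σ_{k∈S} ‖ŵ₀(k)‖² + 2∫_{(0,t]} Flux_S`,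
  `Q_S(s) = 4π² Σ_{k∈S} Re ⟪ŵ(s)(k), T_𝔸(k) ŵ(s)(k)⟫`;
* `ae_blockFlux_eq_remainder` — for `A = 0`, a symmetric block (`k ∈ S ⇒ −k ∈ S`) and a carrier bounded by `M`:
  `Flux_S(s) = ∫⟪w(s) − P_S w(s), (b(s)·∇)P_S w(s)⟫` and
  `|Flux_S(s)| ≤ d·M·(∫‖w(s) − P_S w(s)‖²)^{1/2}·(4π² Σ_{k∈S} |k|² ‖ŵ(s)(k)‖²)^{1/2}`;
* `integral_norm_sq_sub_realTrigPoly_coeff` — Parseval for the complement of a symmetric block: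
  `∫‖v − P_S v‖² = ∫‖v‖² − Σ_{k∈S} ‖v̂(k)‖²` (`v ∈ L²`).

Consumer: the SLOW/FAST splitting of a Bloch-sector-supported cell solution (`S` = the slow modes `{±ℓ}` of the
sector; K1L tensor cell package clause (C), cell `ad-ideate`, stmt-AnomalousDissipation-24912): the slow block
identity is exact, the fast energy is the complement, and its flux is fed only through `(b·∇)P_S w`.

## Mathlib / tree search

Tree: `PassiveVectorTensorGalerkinIdentity` (ball versions, VERBATIM templates: `ae_galerkinFlux_eq_sum`,
`integrableOn_galerkinFlux`, `integrableOn_symbForm`, `ae_sum_sq_norm_mFourierCoeff_eq`, `ae_galerkinFlux_eq_remainder`),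
`PassiveVectorTensorModeEnergy` (`ae_sq_norm_mFourierCoeff_eq`, `integrableOn_modeRHS_self`, `integrableOn_inner_symbT`),
`PassiveVectorFourier` (`integral_inner_convect_realTrigPoly_singleton`), `PassiveVectorGalerkinIdentity`
(`sum_mul_integral_inner_convect_eq`, `abs_integral_inner_convect_le_of_norm_le`, `integral_inner_self_convect_eq_zero_of_isWeaklyDivFree`),
`TorusTrigPoly` (`realTrigPoly`, `integral_norm_sq_realTrigPoly`, `integral_inner_realTrigPoly_right`,
`toReal_eGradNormSq_realTrigPoly`, `isConjSymm_mFourierCoeff`), `TorusFourierModes` (`realTrigPoly_apply_eq_sum`).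

## References

* J. C. Robinson, J. L. Rodrigo, W. Sadowski, *The three-dimensional Navier–Stokes equations* (CUP 2016), §4.1–§4.2, (4.20). [`RobinsonRodrigoSadowski2016`]
* U. Frisch, *Turbulence* (CUP 1995), §9.6.3 eq. (9.57) p. 233. [`Frisch1995Turbulence`]
* L. Grafakos, *Classical Fourier Analysis*, 3rd ed. (2014), Prop. 3.2.7 (3). [`Grafakos2014`]
-/

noncomputable section

open MeasureTheory Set Filter Function TopologicalSpace Complex UnitAddTorus
open scoped ENNReal NNReal InnerProductSpace ComplexConjugate

namespace Literature.Analysis.FluidPDE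

namespace Torus

variable {d : Type*} [Fintype d] [DecidableEq d]

/-! ## A block projection as a sum of single real modes; Parseval for the complement -/

omit [DecidableEq d] in
/-- `P_S u = Σ_{k∈S} Re (e_k • c k)` as a sum of single real modes. [cite: Grafakos2014, §3.1.1 (trigonometric polynomials)] -/
theorem realTrigPoly_eq_sum_singleton (S : Finset (d → ℤ)) (c : (d → ℤ) → EuclideanSpace ℂ d) :
    FunctionSpaces.Torus.realTrigPoly S c = fun y => ∑ k ∈ S,
      (1 : ℝ) • FunctionSpaces.Torus.realTrigPoly {k} c y := by
  funext y
  rw [FunctionSpaces.Torus.realTrigPoly_apply_eq_sum]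
  refine Finset.sum_congr rfl fun k _ => ?_
  rw [one_smul, FunctionSpaces.Torus.realTrigPoly_apply_eq_sum, Finset.sum_singleton]

omit [DecidableEq d] in
/-- **Parseval for the complement of a symmetric block**: for `v ∈ L²` and its own coefficients `v̂`,
`∫‖v − P_S v‖² = ∫‖v‖² − Σ_{k∈S} ‖v̂(k)‖²`. [cite: Grafakos2014, Prop. 3.2.7 (3)] -/
theorem integral_norm_sq_sub_realTrigPoly_coeff {S : Finset (d → ℤ)} (hS : ∀ k ∈ S, -k ∈ S)
    {v : UnitAddTorus d → EuclideanSpace ℝ d} (hv : MemLp v 2 volume) :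
    ∫ x, ‖v x - FunctionSpaces.Torus.realTrigPoly S
        (fun k => mFourierCoeff (FunctionSpaces.EuclideanSpace.complexify ∘ v) k) x‖ ^ 2 =
      (∫ x, ‖v x‖ ^ 2) - ∑ k ∈ S, ‖mFourierCoeff (FunctionSpaces.EuclideanSpace.complexify ∘ v) k‖ ^ 2 := by
  set c : (d → ℤ) → EuclideanSpace ℂ d := fun k => mFourierCoeff (FunctionSpaces.EuclideanSpace.complexify ∘ v) k
    with hc
  have hcs : FunctionSpaces.Torus.IsConjSymm c := FunctionSpaces.Torus.isConjSymm_mFourierCoeff (hv.integrable one_le_two)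
  have hPm : MemLp (FunctionSpaces.Torus.realTrigPoly S c) 2 volume := FunctionSpaces.Torus.memLp_realTrigPoly S c 2
  -- pointwise expansion `‖v − P‖² = ‖v‖² − 2⟪v,P⟫ + ‖P‖²`
  have hpt : ∀ x, ‖v x - FunctionSpaces.Torus.realTrigPoly S c x‖ ^ 2 =
      ‖v x‖ ^ 2 - 2 * ⟪v x, FunctionSpaces.Torus.realTrigPoly S c x⟫_ℝ + ‖FunctionSpaces.Torus.realTrigPoly S c x‖ ^ 2 :=
    fun x => norm_sub_sq_real _ _
  have hi1 : Integrable (fun x => ‖v x‖ ^ 2) volume := hv.integrable_norm_pow two_ne_zero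
  have hi3 : Integrable (fun x => ‖FunctionSpaces.Torus.realTrigPoly S c x‖ ^ 2) volume :=
    hPm.integrable_norm_pow two_ne_zero
  have hi2 : Integrable (fun x => ⟪v x, FunctionSpaces.Torus.realTrigPoly S c x⟫_ℝ) volume := by
    have h : MemLp ((fun x => ‖FunctionSpaces.Torus.realTrigPoly S c x‖) * fun x => ‖v x‖) 1 volume := hv.norm.mul hPm.norm
    refine (memLp_one_iff_integrable.1 h).mono' (hv.1.inner hPm.1) (Eventually.of_forall fun x => ?_)
    rw [Pi.mul_apply, Real.norm_eq_abs, mul_comm]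
    exact abs_real_inner_le_norm _ _
  simp_rw [hpt]
  have e1 : ∫ x, (‖v x‖ ^ 2 - 2 * ⟪v x, FunctionSpaces.Torus.realTrigPoly S c x⟫_ℝ +
      ‖FunctionSpaces.Torus.realTrigPoly S c x‖ ^ 2) =
      ((∫ x, ‖v x‖ ^ 2) - ∫ x, 2 * ⟪v x, FunctionSpaces.Torus.realTrigPoly S c x⟫_ℝ) +
        ∫ x, ‖FunctionSpaces.Torus.realTrigPoly S c x‖ ^ 2 := by
    rw [← integral_sub hi1 (hi2.const_mul 2)]
    exact integral_add (hi1.sub (hi2.const_mul 2)) hi3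
  rw [e1, integral_const_mul, FunctionSpaces.Torus.integral_inner_realTrigPoly_right hS hcs hv,
    FunctionSpaces.Torus.integral_norm_sq_realTrigPoly hS hcs]
  have e : ∀ k ∈ S, (⟪mFourierCoeff (FunctionSpaces.EuclideanSpace.complexify ∘ v) k, c k⟫_ℂ).re = ‖c k‖ ^ 2 := by
    intro k _
    rw [hc]
    exact inner_self_eq_norm_sq (𝕜 := ℂ) _
  rw [Finset.sum_congr rfl e]
  ring

namespace IsWeakTensorPassiveVectorOn

variable {A T : ℝ} {𝔸 : Visc4 d} {b w : ℝ → UnitAddTorus d → EuclideanSpace ℝ d}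
  {w₀ : UnitAddTorus d → EuclideanSpace ℝ d}

/-! ## The transport flux against a block of own modes, in Fourier variables -/

/-- **The transport flux against a block of own modes in Fourier variables**: for a.e. `s ∈ (0,T)` and every finite
`S`, `∫⟪w(s),(b(s)·∇)P_S w(s)⟫ + A∫⟪b(s),(w(s)·∇)P_S w(s)⟫ = Σ_{k∈S} Re B_k(ŵ(s)(k))(s)`
(`P_S w(s) = realTrigPoly S ŵ(s)`; linearity in the test field and the single-mode pairings).
[cite: RobinsonRodrigoSadowski2016, §4.1 (Galerkin truncations)] -/
theorem ae_blockFlux_eq_sum (h : IsWeakTensorPassiveVectorOn A T 𝔸 b w₀ w) :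
    ∀ᵐ s ∂(volume.restrict (Ioo 0 T)), ∀ S : Finset (d → ℤ),
      (∫ x, ⟪w s x, FunctionSpaces.Torus.convect (b s) (FunctionSpaces.Torus.realTrigPoly S
          (fun k => mFourierCoeff (FunctionSpaces.EuclideanSpace.complexify ∘ w s) k)) x⟫_ℝ) +
          A * ∫ x, ⟪b s x, FunctionSpaces.Torus.convect (w s) (FunctionSpaces.Torus.realTrigPoly S
          (fun k => mFourierCoeff (FunctionSpaces.EuclideanSpace.complexify ∘ w s) k)) x⟫_ℝ =
        ∑ k ∈ S,
          ((∑ j, (2 * Real.pi * I * (k j)) *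
              ⟪mFourierCoeff (FunctionSpaces.EuclideanSpace.complexify ∘ fun x => b s x j • w s x) k,
                mFourierCoeff (FunctionSpaces.EuclideanSpace.complexify ∘ w s) k⟫_ℂ) +
            (A : ℂ) * ∑ j, (2 * Real.pi * I * (k j)) *
              ⟪mFourierCoeff (FunctionSpaces.EuclideanSpace.complexify ∘ fun x => w s x j • b s x) k,
                mFourierCoeff (FunctionSpaces.EuclideanSpace.complexify ∘ w s) k⟫_ℂ).re := by
  filter_upwards [h.ae_integrable_slice] with s hs
  intro S
  set c : (d → ℤ) → EuclideanSpace ℂ d := fun k' => mFourierCoeff (FunctionSpaces.EuclideanSpace.complexify ∘ w s) k'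
    with hc
  have ha : ∀ k : d → ℤ, FunctionSpaces.Torus.IsSmooth (FunctionSpaces.Torus.realTrigPoly {k} c) :=
    fun k => FunctionSpaces.Torus.isSmooth_realTrigPoly _ _
  have e1 : ∫ x, ⟪w s x, FunctionSpaces.Torus.convect (b s) (FunctionSpaces.Torus.realTrigPoly S c) x⟫_ℝ =
      ∑ k ∈ S, (∑ j, (2 * Real.pi * I * (k j)) *
        ⟪mFourierCoeff (FunctionSpaces.EuclideanSpace.complexify ∘ fun x => b s x j • w s x) k, c k⟫_ℂ).re := by
    rw [realTrigPoly_eq_sum_singleton S c,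
      ← sum_mul_integral_inner_convect_eq S (fun _ => (1 : ℝ)) ha hs.2.1]
    refine Finset.sum_congr rfl fun k _ => ?_
    rw [one_mul, integral_inner_convect_realTrigPoly_singleton hs.2.1 k c]
  have e2 : ∫ x, ⟪b s x, FunctionSpaces.Torus.convect (w s) (FunctionSpaces.Torus.realTrigPoly S c) x⟫_ℝ =
      ∑ k ∈ S, (∑ j, (2 * Real.pi * I * (k j)) *
        ⟪mFourierCoeff (FunctionSpaces.EuclideanSpace.complexify ∘ fun x => w s x j • b s x) k, c k⟫_ℂ).re := by
    rw [realTrigPoly_eq_sum_singleton S c,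
      ← sum_mul_integral_inner_convect_eq S (fun _ => (1 : ℝ)) ha hs.2.2]
    refine Finset.sum_congr rfl fun k _ => ?_
    rw [one_mul, integral_inner_convect_realTrigPoly_singleton hs.2.2 k c]
  rw [e1, e2, Finset.mul_sum, ← Finset.sum_add_distrib]
  refine Finset.sum_congr rfl fun k _ => ?_
  rw [Complex.add_re, Complex.re_ofReal_mul]

/-- The block flux is integrable on `(0,T)`. [cite: RobinsonRodrigoSadowski2016, §4.2 (Galerkin energy estimate)] -/
theorem integrableOn_blockFlux (h : IsWeakTensorPassiveVectorOn A T 𝔸 b w₀ w) (S : Finset (d → ℤ)) :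
    IntegrableOn (fun s =>
      (∫ x, ⟪w s x, FunctionSpaces.Torus.convect (b s) (FunctionSpaces.Torus.realTrigPoly S
          (fun k => mFourierCoeff (FunctionSpaces.EuclideanSpace.complexify ∘ w s) k)) x⟫_ℝ) +
        A * ∫ x, ⟪b s x, FunctionSpaces.Torus.convect (w s) (FunctionSpaces.Torus.realTrigPoly S
          (fun k => mFourierCoeff (FunctionSpaces.EuclideanSpace.complexify ∘ w s) k)) x⟫_ℝ)
      (Ioo 0 T) volume := by
  have hsum : IntegrableOn (fun s => ∑ k ∈ S,
      ((∑ j, (2 * Real.pi * I * (k j)) *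
          ⟪mFourierCoeff (FunctionSpaces.EuclideanSpace.complexify ∘ fun x => b s x j • w s x) k,
            mFourierCoeff (FunctionSpaces.EuclideanSpace.complexify ∘ w s) k⟫_ℂ) +
        (A : ℂ) * ∑ j, (2 * Real.pi * I * (k j)) *
          ⟪mFourierCoeff (FunctionSpaces.EuclideanSpace.complexify ∘ fun x => w s x j • b s x) k,
            mFourierCoeff (FunctionSpaces.EuclideanSpace.complexify ∘ w s) k⟫_ℂ).re) (Ioo 0 T) volume :=
    integrable_finsetSum _ fun k _ => (h.integrableOn_modeRHS_self k).re
  refine hsum.congr ?_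
  filter_upwards [h.ae_blockFlux_eq_sum] with s hs
  exact (hs S).symm

/-- The block symbol form `s ↦ Q_S(s) = 4π² Σ_{k∈S} Re ⟪ŵ(s)(k), T_𝔸(k) ŵ(s)(k)⟫` is integrable on `(0,T)`.
[cite: Frisch1995Turbulence, §9.6.3 eq. (9.57) p. 233] -/
theorem integrableOn_blockSymbForm (h : IsWeakTensorPassiveVectorOn A T 𝔸 b w₀ w) (S : Finset (d → ℤ)) :
    IntegrableOn (fun s => 4 * Real.pi ^ 2 * ∑ k ∈ S,
      (⟪mFourierCoeff (FunctionSpaces.EuclideanSpace.complexify ∘ w s) k,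
        symbT 𝔸 k (mFourierCoeff (FunctionSpaces.EuclideanSpace.complexify ∘ w s) k)⟫_ℂ).re) (Ioo 0 T) volume :=
  (integrable_finsetSum _ fun k _ => (h.integrableOn_inner_symbT k).re).const_mul _

/-! ## The block energy identity -/

/-- **The energy identity of a finite block of Fourier modes of a weak tensor-viscosity passive-vector solution.**
For a datum `w₀ ∈ L²` weakly divergence free, a.e. `t ∈ (0,T)` and EVERY finite set `S` of frequencies:
`Σ_{k∈S} ‖ŵ(t)(k)‖² + 2 ∫_{(0,t]} Q_S(s) ds = Σ_{k∈S} ‖ŵ₀(k)‖² + 2 ∫_{(0,t]} Flux_S(s) ds`,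
`Flux_S(s) = ∫⟪w(s),(b(s)·∇)P_S w(s)⟫ + A ∫⟪b(s),(w(s)·∇)P_S w(s)⟫` (the one-mode identities summed over `S`).
[cite: RobinsonRodrigoSadowski2016, §4.2 (4.20)] [cite: Frisch1995Turbulence, §9.6.3 eq. (9.57) p. 233] -/
theorem ae_block_energy_identity (h : IsWeakTensorPassiveVectorOn A T 𝔸 b w₀ w) (hw₀ : MemLp w₀ 2 volume)
    (hdiv₀ : FunctionSpaces.Torus.IsWeaklyDivFree w₀) :
    ∀ᵐ t ∂(volume.restrict (Ioo 0 T)), ∀ S : Finset (d → ℤ),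
      (∑ k ∈ S, ‖mFourierCoeff (FunctionSpaces.EuclideanSpace.complexify ∘ w t) k‖ ^ 2) +
          2 * ∫ s in Ioc 0 t, 4 * Real.pi ^ 2 * ∑ k ∈ S,
            (⟪mFourierCoeff (FunctionSpaces.EuclideanSpace.complexify ∘ w s) k,
              symbT 𝔸 k (mFourierCoeff (FunctionSpaces.EuclideanSpace.complexify ∘ w s) k)⟫_ℂ).re =
        (∑ k ∈ S, ‖mFourierCoeff (FunctionSpaces.EuclideanSpace.complexify ∘ w₀) k‖ ^ 2) +
          2 * ∫ s in Ioc 0 t,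
            ((∫ x, ⟪w s x, FunctionSpaces.Torus.convect (b s) (FunctionSpaces.Torus.realTrigPoly S
                (fun k => mFourierCoeff (FunctionSpaces.EuclideanSpace.complexify ∘ w s) k)) x⟫_ℝ) +
              A * ∫ x, ⟪b s x, FunctionSpaces.Torus.convect (w s) (FunctionSpaces.Torus.realTrigPoly S
                (fun k => mFourierCoeff (FunctionSpaces.EuclideanSpace.complexify ∘ w s) k)) x⟫_ℝ) := by
  -- names
  set X : (d → ℤ) → ℝ → EuclideanSpace ℂ d := fun k t =>
    mFourierCoeff (FunctionSpaces.EuclideanSpace.complexify ∘ w t) k with hX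
  set X₀ : (d → ℤ) → EuclideanSpace ℂ d := fun k =>
    mFourierCoeff (FunctionSpaces.EuclideanSpace.complexify ∘ w₀) k with hX₀
  set Bf : (d → ℤ) → ℝ → ℂ := fun k s =>
    (∑ j, (2 * Real.pi * I * (k j)) *
        ⟪mFourierCoeff (FunctionSpaces.EuclideanSpace.complexify ∘ fun x => b s x j • w s x) k, X k s⟫_ℂ) +
      (A : ℂ) * ∑ j, (2 * Real.pi * I * (k j)) *
        ⟪mFourierCoeff (FunctionSpaces.EuclideanSpace.complexify ∘ fun x => w s x j • b s x) k, X k s⟫_ℂ with hBf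
  set Vf : (d → ℤ) → ℝ → ℂ := fun k s => ⟪X k s, symbT 𝔸 k (X k s)⟫_ℂ with hVf
  set Fl : Finset (d → ℤ) → ℝ → ℝ := fun S s =>
    (∫ x, ⟪w s x, FunctionSpaces.Torus.convect (b s) (FunctionSpaces.Torus.realTrigPoly S (fun k => X k s)) x⟫_ℝ) +
      A * ∫ x, ⟪b s x, FunctionSpaces.Torus.convect (w s) (FunctionSpaces.Torus.realTrigPoly S (fun k => X k s)) x⟫_ℝ
    with hFl
  have hHi : ∀ k, IntegrableOn (fun s => ((-(4 * Real.pi ^ 2 : ℝ) : ℂ) * Vf k s + Bf k s).re) (Ioo 0 T) volume :=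
    fun k => (((h.integrableOn_inner_symbT k).const_mul _).add (h.integrableOn_modeRHS_self k)).re
  -- all one-mode identities at once, and the flux identification
  have hmodes := ae_all_iff.2 fun k => h.ae_sq_norm_mFourierCoeff_eq hw₀ hdiv₀ k
  have hflux' : ∀ᵐ s ∂(volume : Measure ℝ), s ∈ Ioo 0 T → ∀ S : Finset (d → ℤ),
      Fl S s = ∑ k ∈ S, (Bf k s).re :=
    (ae_restrict_iff' measurableSet_Ioo).1 h.ae_blockFlux_eq_sum
  filter_upwards [hmodes, ae_restrict_mem measurableSet_Ioo] with t ht htT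
  intro S
  have hsub : Ioc 0 t ⊆ Ioo 0 T := Ioc_subset_Ioo_right htT.2
  -- sum the one-mode identities over the block
  have hsum : ∑ k ∈ S, ‖X k t‖ ^ 2 =
      ∑ k ∈ S, (‖X₀ k‖ ^ 2 + 2 * ∫ s in Ioc 0 t, ((-(4 * Real.pi ^ 2 : ℝ) : ℂ) * Vf k s + Bf k s).re) :=
    Finset.sum_congr rfl fun k _ => ht k
  rw [Finset.sum_add_distrib, ← Finset.mul_sum,
    ← integral_finsetSum _ (fun k _ => (hHi k).mono_set hsub)] at hsum
  -- split the summed integrand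
  have hsplit : ∫ s in Ioc 0 t, ∑ k ∈ S, ((-(4 * Real.pi ^ 2 : ℝ) : ℂ) * Vf k s + Bf k s).re =
      (∫ s in Ioc 0 t, Fl S s) - ∫ s in Ioc 0 t, 4 * Real.pi ^ 2 * ∑ k ∈ S, (Vf k s).re := by
    have hQi : IntegrableOn (fun s => 4 * Real.pi ^ 2 * ∑ k ∈ S, (Vf k s).re) (Ioc 0 t) volume :=
      (h.integrableOn_blockSymbForm S).mono_set hsub
    have hFli : IntegrableOn (Fl S) (Ioc 0 t) volume := (h.integrableOn_blockFlux S).mono_set hsub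
    rw [← integral_sub hFli hQi]
    refine setIntegral_congr_ae measurableSet_Ioc ?_
    filter_upwards [hflux'] with s hs hsI
    rw [hs (hsub hsI) S, Finset.mul_sum, ← Finset.sum_sub_distrib]
    refine Finset.sum_congr rfl fun k _ => ?_
    rw [Complex.add_re, neg_mul, Complex.neg_re, Complex.re_ofReal_mul]
    ring
  rw [hsplit] at hsum
  rw [hX] at hsum
  simp only at hsum
  linarith

/-! ## The block flux for `A = 0`: remainder form and bound -/

omit [DecidableEq d] in
/-- Integrability of `uⱼ • Ψ` for an integrable `u` and a smooth `Ψ`. [cite: RobinsonRodrigoSadowski2016, §4.2 (energy estimate)] -/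
theorem integrable_coord_smul_of_isSmooth {u : UnitAddTorus d → EuclideanSpace ℝ d} (hu : Integrable u volume)
    {Ψ : UnitAddTorus d → EuclideanSpace ℝ d} (hΨ : FunctionSpaces.Torus.IsSmooth Ψ) (j : d) :
    Integrable (fun x => u x j • Ψ x) volume := by
  obtain ⟨C, hC⟩ := (isCompact_univ.image hΨ.continuous).isBounded.exists_norm_le
  have hC' : ∀ x, ‖Ψ x‖ ≤ C := fun x => hC _ ⟨x, mem_univ _, rfl⟩
  refine Integrable.mono' (hu.norm.mul_const C)
    (((EuclideanSpace.proj j).continuous.comp_aestronglyMeasurable hu.1).smul hΨ.continuous.aestronglyMeasurable)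
    (ae_of_all _ fun x => ?_)
  rw [norm_smul]
  exact mul_le_mul (by simpa [Real.norm_eq_abs] using FunctionSpaces.Torus.abs_apply_le_norm (u x) j) (hC' x)
    (norm_nonneg _) (norm_nonneg _)

/-- **The block flux, for `A = 0` and a symmetric block, only sees the complement**, and is controlled by the complement
energy and the block dissipation: for a carrier bounded by `M` a.e., for a.e. `s ∈ (0,T)` and every symmetric `S`,
`Flux_S(s) = ∫⟪w(s) − P_S w(s), (b(s)·∇)P_S w(s)⟫` and
`|Flux_S(s)| ≤ d·M·(∫‖w(s) − P_S w(s)‖²)^{1/2}·(4π² Σ_{k∈S} |k|²‖ŵ(s)(k)‖²)^{1/2}`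
(`∫⟪P_S w,(b·∇)P_S w⟫ = 0` for the weakly divergence-free carrier). [cite: RobinsonRodrigoSadowski2016, §4.2 (4.20)] -/
theorem ae_blockFlux_eq_remainder (h : IsWeakTensorPassiveVectorOn 0 T 𝔸 b w₀ w) {M : ℝ} (hM : 0 ≤ M)
    (hbM : ∀ᵐ s ∂(volume.restrict (Ioo 0 T)), ∀ᵐ x ∂volume, ‖b s x‖ ≤ M) :
    ∀ᵐ s ∂(volume.restrict (Ioo 0 T)), ∀ S : Finset (d → ℤ), (∀ k ∈ S, -k ∈ S) →
      ((∫ x, ⟪w s x, FunctionSpaces.Torus.convect (b s) (FunctionSpaces.Torus.realTrigPoly S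
          (fun k => mFourierCoeff (FunctionSpaces.EuclideanSpace.complexify ∘ w s) k)) x⟫_ℝ) +
          (0 : ℝ) * ∫ x, ⟪b s x, FunctionSpaces.Torus.convect (w s) (FunctionSpaces.Torus.realTrigPoly S
          (fun k => mFourierCoeff (FunctionSpaces.EuclideanSpace.complexify ∘ w s) k)) x⟫_ℝ =
        ∫ x, ⟪w s x - FunctionSpaces.Torus.realTrigPoly S
              (fun k => mFourierCoeff (FunctionSpaces.EuclideanSpace.complexify ∘ w s) k) x,
            FunctionSpaces.Torus.convect (b s) (FunctionSpaces.Torus.realTrigPoly S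
              (fun k => mFourierCoeff (FunctionSpaces.EuclideanSpace.complexify ∘ w s) k)) x⟫_ℝ) ∧
      |∫ x, ⟪w s x - FunctionSpaces.Torus.realTrigPoly S
              (fun k => mFourierCoeff (FunctionSpaces.EuclideanSpace.complexify ∘ w s) k) x,
            FunctionSpaces.Torus.convect (b s) (FunctionSpaces.Torus.realTrigPoly S
              (fun k => mFourierCoeff (FunctionSpaces.EuclideanSpace.complexify ∘ w s) k)) x⟫_ℝ| ≤
        Fintype.card d * M *
          Real.sqrt (∫ x, ‖w s x - FunctionSpaces.Torus.realTrigPoly S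
              (fun k => mFourierCoeff (FunctionSpaces.EuclideanSpace.complexify ∘ w s) k) x‖ ^ 2) *
          Real.sqrt (4 * Real.pi ^ 2 * ∑ k ∈ S, FunctionSpaces.Torus.freqNormSq k *
            ‖mFourierCoeff (FunctionSpaces.EuclideanSpace.complexify ∘ w s) k‖ ^ 2) := by
  filter_upwards [h.ae_integrable_slice, h.ae_memLp_two, h.ae_isWeaklyDivFree_carrier, h.ae_aestronglyMeasurable_slice, hbM]
    with s hs hs2 hbdiv hsm hbs
  intro S hS
  set c : (d → ℤ) → EuclideanSpace ℂ d := fun k => mFourierCoeff (FunctionSpaces.EuclideanSpace.complexify ∘ w s) k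
    with hc
  have hcs : FunctionSpaces.Torus.IsConjSymm c := FunctionSpaces.Torus.isConjSymm_mFourierCoeff hs.1
  have hbint : Integrable (b s) volume := Integrable.of_bound hsm.2 M hbs
  have hPs : FunctionSpaces.Torus.IsSmooth (FunctionSpaces.Torus.realTrigPoly S c) :=
    FunctionSpaces.Torus.isSmooth_realTrigPoly S c
  have i1 := integrable_inner_convect_of_integrable_smul hs.2.1 hPs
  have hPv : ∀ j, Integrable (fun x => b s x j • FunctionSpaces.Torus.realTrigPoly S c x) volume :=
    fun j => integrable_coord_smul_of_isSmooth hbint hPs j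
  have i2 := integrable_inner_convect_of_integrable_smul hPv hPs
  have h0 := integral_inner_self_convect_eq_zero_of_isWeaklyDivFree hbdiv hPs
  have heq : ∫ x, ⟪w s x, FunctionSpaces.Torus.convect (b s) (FunctionSpaces.Torus.realTrigPoly S c) x⟫_ℝ =
      ∫ x, ⟪w s x - FunctionSpaces.Torus.realTrigPoly S c x,
        FunctionSpaces.Torus.convect (b s) (FunctionSpaces.Torus.realTrigPoly S c) x⟫_ℝ := by
    simp_rw [inner_sub_left]
    rw [integral_sub i1 i2, h0, sub_zero]
  refine ⟨?_, ?_⟩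
  · rw [zero_mul, add_zero, heq]
  · have hv : MemLp (fun x => w s x - FunctionSpaces.Torus.realTrigPoly S c x) 2 volume :=
      hs2.sub (FunctionSpaces.Torus.memLp_realTrigPoly S c 2)
    have hb := abs_integral_inner_convect_le_of_norm_le (u := b s) hv hM hbs hPs
    rwa [FunctionSpaces.Torus.gradNormSq_eq_toReal_eGradNormSq_holds hPs,
      FunctionSpaces.Torus.toReal_eGradNormSq_realTrigPoly hS hcs] at hb

end IsWeakTensorPassiveVectorOn

end Torus

end Literature.Analysis.FluidPDE

end
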